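import Summits.BirchSwinnertonDyer.BirchSwinnertonDyer.Theses.SignedLowerHalves
import Summits.BirchSwinnertonDyer.BirchSwinnertonDyer.Theorems.SignedLowerHalvesKobayashiMainConjectureSmallImageOrbitSumMuThree
import Literature.NumberTheory.EllipticCurves.PAdicLFunctionDistributionProofs
import Literature.NumberTheory.EllipticCurves.PAdicLFunctionDistributionHoldsProofs
import Literature.NumberTheory.EllipticCurves.ModularSymbolsLattice
import Literature.NumberTheory.EllipticCurves.ModularSymbolsProofs
import Literature.NumberTheory.EllipticCurves.ModularCurveRealPeriodProofs
import Literature.NumberTheory.EllipticCurves.ModularFormsGamma0Genus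
import Mathlib.NumberTheory.Padics.PadicNorm
import Mathlib.NumberTheory.ModularForms.CongruenceSubgroups
import HarnessLib

/-!
# Crux `KobayashiMainConjectureSmallImage` (item stmt-BirchSwinnertonDyer-19002) — ideator bsd-idea-13, gen 9:
# the SYMBOL STEP of EG-REDUCTION-g8 THEOREM A, kernel-checked (UNREGISTERED workfile, not a line; W-79)

WHAT. `EG-REDUCTION-g8.md` (this crux's workfiles) reduces the one-sign μ-rider at `p = 3` to a pure
group-theoretic statement LEMMA′(N,p) about `Γ₀(N)` plus a "symbol step" (§4). This file PROVES the symbol step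
for every odd prime `p ∤ N` with `a_p(f) = 0`:

* `not_allNonUnit_of_lemmaPrimeHom` : `LemmaPrimeHom N p` (LEMMA′ in homomorphism form: every hom `Γ₀(N) → A`,
  `A` abelian, killing the ±p-power-cusp set `S_p` kills `Γ′ = {d ≡ ±p^k mod N}`) ⟹ NOT every plus symbol
  `[a/p^k]⁺_f` (`k ≥ 1`, `p ∤ a`) has `p`-adic norm `< 1`.

  Proof (MTT (4.2) `intCast_mul_ratPlusSymbol`, Manin `modularSymbol_gamma0_smul`, the lattice
  `Re Λ_f = ℤ·Ω⁺_f/2` `realPeriods_eq_zmultiples_of_plusPeriod_pos`): with `R = [·]⁺_f ∈ ℚ` and the surjective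
  homomorphism `k_f : Γ₀(N) → ℤ`, `Re{∞,γ∞} = k_f(γ)·Ω⁺/2`, one has `R(b/d) − R(0) = k_f(γ)/2` for `γ = (a b;c d)`.
  If all `R(a/p^k) ∈ pℤ_(p)`: Hecke at `r = 0` gives `2R(0) = −Σ_{0<j<p} R(j/p) ∈ pℤ_(p)`; hence `k_f ≡ 0 mod p` on
  `S_p`, so (LEMMA′) on `Γ′`, so `k_f(γ) mod p` depends only on `d(γ)·p^ℤ mod N`; Hecke at `r = 1/v`
  (`(v,Np)=1`) then reads `0 ≡ (p+1)(R(0) + k_v/2) mod p`, so `p ∣ k_v`, so `p ∣ k_f(γ)` for all `γ` — contradicting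
  `k_f(γ₁) = 1`.
* `not_allNonUnit_of_lemmaPrimeHom_of_cuspCoeff` / `not_allNonUnit_and_of_lemmaPrimeHom` (rev2): the same
  with `a_p = 0` replaced by `a_p ≢ 1 (mod p)` and `R(0) ∈ pℤ_(p)` as a hypothesis — the symbol step of the
  critic's THEOREM A′ (V40 (e): ordinary non-anomalous `μ(L_p(f)) = 0 ⟸ LEMMA′`; the ordinary hinge
  `μ ≥ 1 ⇒ R(0) ∈ pℤ_p ∧ AllNonUnit` is classical and NOT formalised here).
* `exists_sign_hasUnitContent_three_of_lemmaPrimeHom` : at `p = 3`, with the LEAD's landed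
  `SmallImageOrbitSumMuThree.norm_ratPlusSymbol_three_lt_one_of_not_hasUnitContent` (p636964) and the tree THEOREM
  `pollack_exists_plusMinusPAdicLFunction_holds`: `LemmaPrimeHom N 3` ⟹ `∃ ε L, IsSignedPAdicLFunction f 3 ε L ∧
  HasUnitContent L` for the newform `f` of any `E` with good supersingular reduction at 3 (`a₃ = 0`).
* `muOneSign_ns_three_of_lemmaPrimeHom` : hence the v6 rider of line `birth_acns` in its `∃ ε₀ L₀` form follows from
  the single group-theoretic input `∀ N, ¬ 3 ∣ N → LemmaPrimeHom N 3` (paper proof: EG-REDUCTION-g8 §3 = finite index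
  [Venkataramana 1994, Thm. p.194; Vaserstein 1972] + CSP [Mennicke 1967; Serre 1970] + elementary generation + the
  kernel-checked coset lemma `EGCosetLemma.lean`).

* `exists_norm_ratPlusSymbol_three_eq_one_of_lemmaPrimeHom` / `stub_muOneSign_ns_three_of_lemmaPrimeHom` : the v6
  stub `stub_muOneSign_ns_three` of line `birth_acns` EXACTLY AS TYPED (a unit plus symbol `[u/3^{n+1}]⁺_f`), from
  `∀ N, ¬ 3 ∣ N → LemmaPrimeHom N 3`, adding the tree's integrality `norm_ratPlusSymbol_div_pow_le_one`.

HONEST SCOPE. ENTIRELY SORRY-FREE (farm rc 0, 0 sorries): LEMMA′ enters only as the HYPOTHESIS `LemmaPrimeHom N 3`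
(published-input-level group theory, paper proof EG-REDUCTION-g8 §3; NOT proved here and not asserted). Proves no
route item; crux 4 of route SignedLowerHalves stays OPEN; BSD is not proved by this seat. For LEAD slh-p3: keep v6 and
add ONE stub `stub_lemmaPrimeHom_three : ∀ N : ℕ, ¬ 3 ∣ N → LemmaPrimeHom N 3`, closing `stub_muOneSign_ns_three :=
EGLine.stub_muOneSign_ns_three_of_lemmaPrimeHom stub_lemmaPrimeHom_three` (this file is an unregistered workfile;
copy the needed declarations or have it promoted to `Theorems/` by a prover — W-79: this seat registers nothing).

References: [MazurTateTeitelbaum1986Invent] §I.4 (4.2), §I.8; [Manin1972] §1.5–1.7, Cor. 3.6; [Pollack2003] §6;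
[Venkataramana1994PJM] Theorem (p. 194); EG-REDUCTION-g8.md §2–§4 (this crux's workfiles).
-/

set_option linter.dupNamespace false
set_option autoImplicit false

noncomputable section

open scoped Classical MatrixGroups ModularForm

namespace Summit.BirchSwinnertonDyer.BirchSwinnertonDyer.Cruxes.KobayashiMainConjectureSmallImage.EGLine

open CongruenceSubgroup Literature.NumberTheory.EllipticCurves
  Literature.NumberTheory.EllipticCurves.ModularForms
  Literature.NumberTheory.EllipticCurves.Kobayashi2003
  Literature.NumberTheory.EllipticCurves.GreenbergVatsal2000
  Literature.NumberTheory.EllipticCurves.Rank1Residual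

/-! ## §0 The group-theoretic sets and LEMMA′ (verbatim from `EGSketch_g8.lean`) -/

/-- `S_p`: elements of `Γ₀(N)` whose lower-right entry is `± p^k`. -/
def pPowerCuspSet (N p : ℕ) : Set SL(2, ℤ) :=
  {γ | γ ∈ Gamma0 N ∧ ∃ k : ℕ, ((γ : Matrix (Fin 2) (Fin 2) ℤ) 1 1 = (p : ℤ) ^ k ∨
    (γ : Matrix (Fin 2) (Fin 2) ℤ) 1 1 = -((p : ℤ) ^ k))}

/-- `Γ′`: elements of `Γ₀(N)` whose lower-right entry is `≡ ± p^k (mod N)`. -/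
def gammaPrimeSet (N p : ℕ) : Set SL(2, ℤ) :=
  {γ | γ ∈ Gamma0 N ∧ ∃ k : ℕ, (((γ : Matrix (Fin 2) (Fin 2) ℤ) 1 1 : ℤ) : ZMod N) = (p : ZMod N) ^ k ∨
    (((γ : Matrix (Fin 2) (Fin 2) ℤ) 1 1 : ℤ) : ZMod N) = -((p : ZMod N) ^ k)}

/-- LEMMA′ in homomorphism form: a hom to an abelian group killing `S_p` kills `Γ′`. -/
def LemmaPrimeHom (N p : ℕ) : Prop :=
  ∀ (A : Type) [CommGroup A] (ψ : Gamma0 N →* A),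
    (∀ γ : Gamma0 N, (γ : SL(2, ℤ)) ∈ pPowerCuspSet N p → ψ γ = 1) →
    ∀ γ : Gamma0 N, (γ : SL(2, ℤ)) ∈ gammaPrimeSet N p → ψ γ = 1

/-! ## §1 `p`-adic bookkeeping -/

section Padic

variable {p : ℕ} [hp : Fact p.Prime]

theorem padicNorm_add_lt_one {q r : ℚ} (hq : padicNorm p q < 1) (hr : padicNorm p r < 1) :
    padicNorm p (q + r) < 1 :=
  lt_of_le_of_lt (padicNorm.nonarchimedean (p := p)) (max_lt hq hr)

theorem padicNorm_sub_lt_one {q r : ℚ} (hq : padicNorm p q < 1) (hr : padicNorm p r < 1) :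
    padicNorm p (q - r) < 1 :=
  lt_of_le_of_lt (padicNorm.sub (p := p)) (max_lt hq hr)

theorem padicNorm_sum_lt_one {α : Type*} (s : Finset α) (g : α → ℚ)
    (h : ∀ i ∈ s, padicNorm p (g i) < 1) : padicNorm p (∑ i ∈ s, g i) < 1 := by
  induction s using Finset.induction_on with
  | empty => simp
  | insert a s ha ih =>
    rw [Finset.sum_insert ha]
    exact padicNorm_add_lt_one (h a (Finset.mem_insert_self a s))
      (ih fun i hi => h i (Finset.mem_insert_of_mem hi))

/-- `|2|_p = 1` for an odd prime `p`. -/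
theorem padicNorm_two (hp2 : p ≠ 2) : padicNorm p (2 : ℚ) = 1 := by
  have h := padicNorm.padicNorm_of_prime_of_ne (p := p) (q := 2) hp2
  exact_mod_cast h

/-- An integer `k` with `|k/2|_p < 1` (`p` odd) is divisible by `p`. -/
theorem dvd_of_padicNorm_div_two_lt_one (hp2 : p ≠ 2) {k : ℤ}
    (h : padicNorm p ((k : ℚ) / 2) < 1) : (p : ℤ) ∣ k := by
  rw [padicNorm.div, padicNorm_two hp2, div_one] at h
  exact (padicNorm.int_lt_one_iff k).mp h

/-- `|p·m/2|_p < 1` for an integer `m` (`p` odd). -/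
theorem padicNorm_p_mul_int_div_two_lt_one (hp2 : p ≠ 2) (m : ℤ) :
    padicNorm p ((p : ℚ) * m / 2) < 1 := by
  rw [padicNorm.div, padicNorm_two hp2, div_one, padicNorm.mul]
  calc padicNorm p (p : ℚ) * padicNorm p (m : ℚ)
      ≤ padicNorm p (p : ℚ) * 1 := by
        gcongr
        · exact padicNorm.nonneg _
        · exact padicNorm.of_int m
    _ < 1 := by rw [mul_one]; exact padicNorm.padicNorm_p_lt_one_of_prime

end Padic

/-! ## §2 Elements of `Γ₀(N)` with a prescribed right column -/

/-- For `(t, s·N) = 1` there is `γ = (u s; −wN t) ∈ Γ₀(N)` with right column `(s, t)`. -/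
theorem exists_gamma0_entries (N : ℕ) (s t : ℤ) (h : IsCoprime t (s * N)) :
    ∃ γ : Gamma0 N, ((γ : SL(2, ℤ)) 0 1 : ℤ) = s ∧ ((γ : SL(2, ℤ)) 1 1 : ℤ) = t := by
  obtain ⟨u, w, huw⟩ := h
  let M : SL(2, ℤ) := ⟨!![u, s; -(w * N), t], by
    rw [Matrix.det_fin_two_of]; linear_combination huw⟩
  have hM : M ∈ Gamma0 N := by
    rw [Gamma0_mem]
    show (((-(w * (N : ℤ))) : ℤ) : ZMod N) = 0
    push_cast
    simp
  exact ⟨⟨M, hM⟩, rfl, rfl⟩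

/-! ## §3 The integer period homomorphism `k_f : Γ₀(N) → ℤ`, `Re{∞, γ∞}_f = k_f(γ)·Ω⁺_f/2` -/

section Period

variable {N : ℕ} [NeZero N] (f : CuspForm (Gamma0 N) 2)

/-- `k_f(γ)`: the integer with `Re {∞, γ∞}_f = k · Ω⁺_f/2` (an `ε`-junk value if there is none). -/
def kOf (γ : Gamma0 N) : ℤ :=
  Classical.epsilon fun k : ℤ => (cuspSymbol f γ).re = (k : ℝ) * (plusPeriod f / 2)

variable {f}

theorem exists_int_re_cuspSymbol (hΩ : 0 < plusPeriod f) (γ : Gamma0 N) :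
    ∃ k : ℤ, (cuspSymbol f γ).re = (k : ℝ) * (plusPeriod f / 2) := by
  have hmem : (cuspSymbol f γ).re ∈ realPeriods f :=
    AddSubgroup.mem_map_of_mem _ (cuspSymbol_mem_periodLattice f γ)
  rw [realPeriods_eq_zmultiples_of_plusPeriod_pos f hΩ, AddSubgroup.mem_zmultiples_iff] at hmem
  obtain ⟨k, hk⟩ := hmem
  exact ⟨k, by rw [← hk, zsmul_eq_mul]⟩

theorem kOf_spec (hΩ : 0 < plusPeriod f) (γ : Gamma0 N) :
    (cuspSymbol f γ).re = (kOf f γ : ℝ) * (plusPeriod f / 2) :=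
  Classical.epsilon_spec (exists_int_re_cuspSymbol hΩ γ)

theorem kOf_eq_of_re_eq (hΩ : 0 < plusPeriod f) {γ : Gamma0 N} {k : ℤ}
    (hk : (cuspSymbol f γ).re = (k : ℝ) * (plusPeriod f / 2)) : kOf f γ = k := by
  have h := kOf_spec hΩ γ
  rw [hk] at h
  have hΩ2 : (plusPeriod f / 2) ≠ 0 := by positivity
  exact_mod_cast (mul_right_cancel₀ hΩ2 h).symm

theorem kOf_mul (hΩ : 0 < plusPeriod f) (γ δ : Gamma0 N) :
    kOf f (γ * δ) = kOf f γ + kOf f δ := by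
  apply kOf_eq_of_re_eq hΩ
  rw [cuspSymbol_mul_holds f γ δ, Complex.add_re, kOf_spec hΩ γ, kOf_spec hΩ δ]
  push_cast; ring

theorem kOf_one (hΩ : 0 < plusPeriod f) : kOf f 1 = 0 := by
  apply kOf_eq_of_re_eq hΩ
  simp

theorem kOf_inv (hΩ : 0 < plusPeriod f) (γ : Gamma0 N) : kOf f γ⁻¹ = -kOf f γ := by
  have h := kOf_mul hΩ γ⁻¹ γ
  rw [inv_mul_cancel, kOf_one hΩ] at h
  omega

/-- `k_f` is onto `ℤ`: some `γ₁` has `k_f(γ₁) = 1` (`Re Λ_f = ℤ·Ω⁺/2`). -/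
theorem exists_kOf_eq_one (hΩ : 0 < plusPeriod f) : ∃ γ : Gamma0 N, kOf f γ = 1 := by
  have hmem : plusPeriod f / 2 ∈ realPeriods f := by
    rw [realPeriods_eq_zmultiples_of_plusPeriod_pos f hΩ]
    exact AddSubgroup.mem_zmultiples _
  obtain ⟨z, hz, hzre⟩ := AddSubgroup.mem_map.mp hmem
  have hz' : z ∈ (periodLattice f : Set ℂ) := hz
  rw [coe_periodLattice_eq_range f] at hz'
  obtain ⟨γ, rfl⟩ := hz'
  refine ⟨γ, kOf_eq_of_re_eq hΩ ?_⟩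
  have h : (cuspSymbol f γ).re = plusPeriod f / 2 := hzre
  rw [h]; push_cast; ring

/-- `γ ↦ k_f(γ) mod p`, as a hom to the abelian group `Multiplicative (ZMod p)`. -/
def kHomMod (hΩ : 0 < plusPeriod f) (p : ℕ) : Gamma0 N →* Multiplicative (ZMod p) where
  toFun γ := Multiplicative.ofAdd ((kOf f γ : ℤ) : ZMod p)
  map_one' := by simp [kOf_one hΩ]
  map_mul' γ δ := by simp [kOf_mul hΩ, ofAdd_add]

theorem kHomMod_eq_one_iff (hΩ : 0 < plusPeriod f) (p : ℕ) (γ : Gamma0 N) :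
    kHomMod hΩ p γ = 1 ↔ (p : ℤ) ∣ kOf f γ := by
  change Multiplicative.ofAdd ((kOf f γ : ℤ) : ZMod p) = 1 ↔ _
  rw [ofAdd_eq_one, ZMod.intCast_zmod_eq_zero_iff_dvd]

end Period

/-! ## §4 The symbol step -/

section StepB

variable {N : ℕ} [NeZero N] {f : CuspForm (Gamma0 N) 2} {p : ℕ} [hp : Fact p.Prime]

/-- The hypothesis REFUTED by the symbol step: every `[a/p^k]⁺_f` (`k ≥ 1`, `(a,p) = 1`) lies in `pℤ_(p)`. -/
def AllNonUnit (f : CuspForm (Gamma0 N) 2) (p : ℕ) : Prop :=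
  ∀ (k : ℕ) (a : ℤ), 0 < k → IsCoprime a (p : ℤ) →
    padicNorm p (ratPlusSymbol f ((a : ℚ) / (p : ℚ) ^ k)) < 1

/-- `R(r)·Ω⁺_f = Re {∞, r}_f` for a rational newform (`ratCast_ratPlusSymbol`, `plusSymbol_eq_re`). -/
theorem ratPlusSymbol_mul_plusPeriod (hf : IsNewform0 f) (hQ : coeffField f = ⊥) (r : ℚ) :
    ((ratPlusSymbol f r : ℚ) : ℝ) * plusPeriod f = (modularSymbol f r).re := by
  have hΩ := IsNewform0.plusPeriod_pos_holds hf hQ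
  have hrat := ratCast_ratPlusSymbol_holds hf hQ r
  have hre := plusSymbol_eq_re_holds f (cuspCoeff_im_eq_zero_of_coeffField_eq_bot hQ) r
  rw [hrat]
  unfold normalizedPlusSymbol
  rw [div_mul_cancel₀ _ hΩ.ne', hre]
  simp

/-- **Manin's relation read on plus symbols**: `R(b/d) − R(0) = k_f(γ)/2` for `γ = (a b; c d) ∈ Γ₀(N)`, `d ≠ 0`. -/
theorem ratPlusSymbol_sub_eq_kOf (hf : IsNewform0 f) (hQ : coeffField f = ⊥) (γ : Gamma0 N)
    (hd : ((γ : SL(2, ℤ)) 1 1 : ℤ) ≠ 0) :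
    ratPlusSymbol f ((((γ : SL(2, ℤ)) 0 1 : ℤ) : ℚ) / (((γ : SL(2, ℤ)) 1 1 : ℤ) : ℚ))
      - ratPlusSymbol f 0 = (kOf f γ : ℚ) / 2 := by
  have hΩ := IsNewform0.plusPeriod_pos_holds hf hQ
  have hsmul := modularSymbol_gamma0_smul_holds f γ 0 (by simpa using hd)
  simp only [mul_zero, zero_add] at hsmul
  have h1 := ratPlusSymbol_mul_plusPeriod hf hQ
    ((((γ : SL(2, ℤ)) 0 1 : ℤ) : ℚ) / (((γ : SL(2, ℤ)) 1 1 : ℤ) : ℚ))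
  have h0 := ratPlusSymbol_mul_plusPeriod hf hQ 0
  have hk := kOf_spec hΩ γ
  have hΩ0 : plusPeriod f ≠ 0 := hΩ.ne'
  have key : (((ratPlusSymbol f ((((γ : SL(2, ℤ)) 0 1 : ℤ) : ℚ) / (((γ : SL(2, ℤ)) 1 1 : ℤ) : ℚ)) : ℚ) : ℝ)
      - ((ratPlusSymbol f 0 : ℚ) : ℝ)) * plusPeriod f = ((kOf f γ : ℝ) / 2) * plusPeriod f := by
    have e1 : (modularSymbol f ((((γ : SL(2, ℤ)) 0 1 : ℤ) : ℚ) / (((γ : SL(2, ℤ)) 1 1 : ℤ) : ℚ))).re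
        = (cuspSymbol f γ).re + (modularSymbol f 0).re := by
      have := congrArg Complex.re hsmul
      simpa using this
    rw [sub_mul, h1, h0, e1, hk]; ring
  have key' := mul_right_cancel₀ hΩ0 key
  have : (((ratPlusSymbol f ((((γ : SL(2, ℤ)) 0 1 : ℤ) : ℚ) / (((γ : SL(2, ℤ)) 1 1 : ℤ) : ℚ))
      - ratPlusSymbol f 0 : ℚ)) : ℝ) = (((kOf f γ : ℚ) / 2 : ℚ) : ℝ) := by
    push_cast; exact key'
  exact_mod_cast this

/-- **Step B1**: under `AllNonUnit`, `R(0) ∈ pℤ_(p)` (Hecke at `r = 0` with `a_p = 0`, `p` odd). -/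
theorem padicNorm_ratPlusSymbol_zero_lt_one (hf : IsNewform0 f) (hQ : coeffField f = ⊥)
    (hp2 : p ≠ 2) (hpN : ¬ p ∣ N) (hap : cuspCoeff f p = 0) (hH : AllNonUnit f p) :
    padicNorm p (ratPlusSymbol f 0) < 1 := by
  haveI : NeZero p := ⟨hp.out.ne_zero⟩
  have hrat : ∀ r : ℚ, (ratPlusSymbol f r : ℝ) = normalizedPlusSymbol f r :=
    fun r => ratCast_ratPlusSymbol_holds hf hQ r
  have hap' : cuspCoeff f p = ((0 : ℤ) : ℂ) := by rw [hap]; simp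
  have hHecke := intCast_mul_ratPlusSymbol p hf hp.out hpN hap' hrat 0
  simp only [Int.cast_zero, zero_mul, zero_add, mul_zero] at hHecke
  rw [← Finset.add_sum_erase Finset.univ _ (Finset.mem_univ (0 : Fin p))] at hHecke
  simp only [Fin.val_zero, Nat.cast_zero, zero_div] at hHecke
  -- hHecke : 0 = R 0 + ∑_{j ≠ 0} R (j/p) + R 0
  have hS : padicNorm p (∑ j ∈ Finset.univ.erase (0 : Fin p),
      ratPlusSymbol f (((j : ℕ) : ℚ) / (p : ℚ))) < 1 := by
    apply padicNorm_sum_lt_one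
    intro j hj
    have hj0 : (j : ℕ) ≠ 0 := by
      intro h
      exact (Finset.mem_erase.mp hj).1 (Fin.ext (by rw [h]; simp))
    have hcop : IsCoprime ((j : ℕ) : ℤ) (p : ℤ) :=
      Nat.isCoprime_iff_coprime.mpr
        (((Nat.Prime.coprime_iff_not_dvd hp.out).mpr
          (Nat.not_dvd_of_pos_of_lt (Nat.pos_of_ne_zero hj0) j.isLt)).symm)
    have := hH 1 ((j : ℕ) : ℤ) one_pos hcop
    simpa using this
  have h2 : (2 : ℚ) * ratPlusSymbol f 0 = -(∑ j ∈ Finset.univ.erase (0 : Fin p),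
      ratPlusSymbol f (((j : ℕ) : ℚ) / (p : ℚ))) := by linarith
  have h3 : padicNorm p ((2 : ℚ) * ratPlusSymbol f 0) < 1 := by
    rw [h2, padicNorm.neg]; exact hS
  rwa [padicNorm.mul, padicNorm_two hp2, one_mul] at h3

/-- **Step B3**: under `AllNonUnit`, `p ∣ k_f(γ)` for every `γ ∈ S_p` (`d = ±p^e`: `R(b/d) ∈ pℤ_(p)` by
hypothesis if `e ≥ 1`, `= R(0)` if `e = 0`). -/
theorem dvd_kOf_of_mem_pPowerCuspSet (hf : IsNewform0 f) (hQ : coeffField f = ⊥)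
    (hp2 : p ≠ 2) (hR0 : padicNorm p (ratPlusSymbol f 0) < 1) (hH : AllNonUnit f p)
    (γ : Gamma0 N) (hγ : (γ : SL(2, ℤ)) ∈ pPowerCuspSet N p) : (p : ℤ) ∣ kOf f γ := by
  obtain ⟨-, e, he⟩ := hγ
  have hdet := Matrix.SpecialLinearGroup.det_coe (γ : SL(2, ℤ))
  rw [Matrix.det_fin_two] at hdet
  have hpe : ((p : ℤ) ^ e) ≠ 0 := pow_ne_zero _ (by exact_mod_cast hp.out.ne_zero)
  have hd0 : ((γ : SL(2, ℤ)) 1 1 : ℤ) ≠ 0 := by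
    rcases he with h | h
    · rw [show ((γ : SL(2, ℤ)) 1 1 : ℤ) = (p : ℤ) ^ e from h]; exact hpe
    · rw [show ((γ : SL(2, ℤ)) 1 1 : ℤ) = -((p : ℤ) ^ e) from h]; exact neg_ne_zero.mpr hpe
  have hdiff := ratPlusSymbol_sub_eq_kOf hf hQ γ hd0
  -- |R(b/d)|_p < 1
  have hR : padicNorm p (ratPlusSymbol f ((((γ : SL(2, ℤ)) 0 1 : ℤ) : ℚ) /
      (((γ : SL(2, ℤ)) 1 1 : ℤ) : ℚ))) < 1 := by
    rcases Nat.eq_zero_or_pos e with he0 | he0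
    · -- d = ±1: the symbol is R(±b) = R(0)
      rcases he with h | h
      · have hd1 : ((γ : SL(2, ℤ)) 1 1 : ℤ) = 1 := by
          rw [show ((γ : SL(2, ℤ)) 1 1 : ℤ) = (p : ℤ) ^ e from h, he0, pow_zero]
        have := ratPlusSymbol_add_intCast_eq f 0 ((γ : SL(2, ℤ)) 0 1 : ℤ)
        rw [zero_add] at this
        rw [hd1, Int.cast_one, div_one, this]; exact hR0
      · have hd1 : ((γ : SL(2, ℤ)) 1 1 : ℤ) = -1 := by
          rw [show ((γ : SL(2, ℤ)) 1 1 : ℤ) = -((p : ℤ) ^ e) from h, he0, pow_zero]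
        have := ratPlusSymbol_add_intCast_eq f 0 (-((γ : SL(2, ℤ)) 0 1 : ℤ))
        rw [zero_add] at this
        have e1 : ((((γ : SL(2, ℤ)) 0 1 : ℤ) : ℚ) / (((-1 : ℤ)) : ℚ)) = (((-((γ : SL(2, ℤ)) 0 1 : ℤ)) : ℤ) : ℚ) := by
          push_cast; ring
        rw [hd1, e1, this]; exact hR0
    · rcases he with h | h
      · have hcop : IsCoprime ((γ : SL(2, ℤ)) 0 1 : ℤ) (p : ℤ) := by
          have hbd : IsCoprime ((γ : SL(2, ℤ)) 0 1 : ℤ) ((p : ℤ) ^ e) :=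
            ⟨-((γ : SL(2, ℤ)) 1 0 : ℤ), ((γ : SL(2, ℤ)) 0 0 : ℤ), by
              rw [← show ((γ : SL(2, ℤ)) 1 1 : ℤ) = (p : ℤ) ^ e from h]; linear_combination hdet⟩
          exact (IsCoprime.pow_right_iff he0).mp hbd
        have := hH e _ he0 hcop
        rw [show ((γ : SL(2, ℤ)) 1 1 : ℤ) = (p : ℤ) ^ e from h]; push_cast; exact this
      · have hcop : IsCoprime (-((γ : SL(2, ℤ)) 0 1 : ℤ)) (p : ℤ) := by
          have hbd : IsCoprime ((γ : SL(2, ℤ)) 0 1 : ℤ) ((p : ℤ) ^ e) :=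
            ⟨-((γ : SL(2, ℤ)) 1 0 : ℤ), -((γ : SL(2, ℤ)) 0 0 : ℤ), by
              rw [show ((p : ℤ) ^ e) = -((γ : SL(2, ℤ)) 1 1 : ℤ) from by rw [h]; ring]
              linear_combination hdet⟩
          exact ((IsCoprime.pow_right_iff he0).mp hbd).neg_left
        have := hH e _ he0 hcop
        rw [show ((γ : SL(2, ℤ)) 1 1 : ℤ) = -((p : ℤ) ^ e) from h]
        have e1 : ((((γ : SL(2, ℤ)) 0 1 : ℤ) : ℚ) / (((-((p : ℤ) ^ e)) : ℤ) : ℚ))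
            = (((-((γ : SL(2, ℤ)) 0 1 : ℤ)) : ℤ) : ℚ) / (p : ℚ) ^ e := by
          push_cast; rw [div_neg, neg_div]
        rw [e1]; exact this
  have h := padicNorm_sub_lt_one hR hR0
  rw [hdiff] at h
  exact dvd_of_padicNorm_div_two_lt_one hp2 h

/-- **Step B4** (LEMMA′ applied to `k_f mod p`): `p ∣ k_f` on `S_p` ⟹ `p ∣ k_f` on `Γ′`. -/
theorem dvd_kOf_of_mem_gammaPrimeSet (hΩ : 0 < plusPeriod f) (hL : LemmaPrimeHom N p)
    (hS : ∀ γ : Gamma0 N, (γ : SL(2, ℤ)) ∈ pPowerCuspSet N p → (p : ℤ) ∣ kOf f γ)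
    (γ : Gamma0 N) (hγ : (γ : SL(2, ℤ)) ∈ gammaPrimeSet N p) : (p : ℤ) ∣ kOf f γ := by
  have h := hL (Multiplicative (ZMod p)) (kHomMod hΩ p)
    (fun δ hδ => (kHomMod_eq_one_iff hΩ p δ).mpr (hS δ hδ)) γ hγ
  exact (kHomMod_eq_one_iff hΩ p γ).mp h

/-- **Step B5a**: if `p ∣ k_f` on `Γ′`, then `k_f(γ) ≡ k_f(γ') (mod p)` whenever `d(γ) ≡ d(γ')·p^e (mod N)`
(`γ γ'⁻¹ ∈ Γ′`, its lower-right entry being `≡ d d'⁻¹ ≡ p^e`). -/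
theorem dvd_kOf_sub_of_apply_eq (hΩ : 0 < plusPeriod f)
    (hΓ : ∀ γ : Gamma0 N, (γ : SL(2, ℤ)) ∈ gammaPrimeSet N p → (p : ℤ) ∣ kOf f γ)
    (γ γ' : Gamma0 N) (e : ℕ)
    (h : (((γ : SL(2, ℤ)) 1 1 : ℤ) : ZMod N) = (((γ' : SL(2, ℤ)) 1 1 : ℤ) : ZMod N) * (p : ZMod N) ^ e) :
    (p : ℤ) ∣ kOf f γ - kOf f γ' := by
  have hc : (((γ : SL(2, ℤ)) 1 0 : ℤ) : ZMod N) = 0 := Gamma0_mem.mp γ.2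
  have hc' : (((γ' : SL(2, ℤ)) 1 0 : ℤ) : ZMod N) = 0 := Gamma0_mem.mp γ'.2
  have hdet' := Matrix.SpecialLinearGroup.det_coe (γ' : SL(2, ℤ))
  rw [Matrix.det_fin_two] at hdet'
  have hdetZ : (((γ' : SL(2, ℤ)) 0 0 : ℤ) : ZMod N) * (((γ' : SL(2, ℤ)) 1 1 : ℤ) : ZMod N) = 1 := by
    have h1 := congrArg (fun z : ℤ => (z : ZMod N)) hdet'
    simp only [Int.cast_sub, Int.cast_mul, Int.cast_one, hc', mul_zero, sub_zero] at h1
    exact h1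
  have hentry : (((γ * γ'⁻¹ : Gamma0 N) : SL(2, ℤ)) 1 1 : ℤ) =
      -(((γ : SL(2, ℤ)) 1 0 : ℤ) * ((γ' : SL(2, ℤ)) 0 1 : ℤ)) +
        ((γ : SL(2, ℤ)) 1 1 : ℤ) * ((γ' : SL(2, ℤ)) 0 0 : ℤ) := by
    have e1 : ((γ * γ'⁻¹ : Gamma0 N) : SL(2, ℤ)) = (γ : SL(2, ℤ)) * (γ' : SL(2, ℤ))⁻¹ := rfl
    rw [e1, Matrix.SpecialLinearGroup.SL2_inv_expl]
    simp [Matrix.mul_apply, Fin.sum_univ_two]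
  have hmem : ((γ * γ'⁻¹ : Gamma0 N) : SL(2, ℤ)) ∈ gammaPrimeSet N p := by
    refine ⟨(γ * γ'⁻¹).2, e, Or.inl ?_⟩
    show ((((γ * γ'⁻¹ : Gamma0 N) : SL(2, ℤ)) 1 1 : ℤ) : ZMod N) = (p : ZMod N) ^ e
    rw [hentry]; push_cast; rw [hc, h]
    linear_combination ((p : ZMod N) ^ e) * hdetZ
  have h2 := hΓ _ hmem
  rwa [kOf_mul hΩ, kOf_inv hΩ, ← sub_eq_add_neg] at h2

/-- **Step B5b, general `a_p`** (Hecke at `r = 1/v`): under `R(0) ∈ pℤ_(p)`, `AllNonUnit`, `p ∤ a_p − 1`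
(non-anomalous) and LEMMA′, `p ∣ k_f(γ_v)` for every `γ_v ∈ Γ₀(N)` with lower-right entry a positive integer `v`
prime to `Np`.  Covers `a_p = 0` (supersingular, THEOREM A) and `a_p ≢ 0, 1 mod p` (ordinary non-anomalous,
THEOREM A′ of critic verdict V40). -/
theorem dvd_kOf_of_apply_eq_nat_of_cuspCoeff (hf : IsNewform0 f) (hQ : coeffField f = ⊥)
    (hp2 : p ≠ 2) (hpN : ¬ p ∣ N) {ap : ℤ} (hap' : cuspCoeff f p = ap) (hap1 : ¬ (p : ℤ) ∣ ap - 1)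
    (hR0 : padicNorm p (ratPlusSymbol f 0) < 1) (hH : AllNonUnit f p)
    (hL : LemmaPrimeHom N p) (v : ℕ) (hv0 : 0 < v) (hvN : Nat.Coprime v N) (hvp : ¬ p ∣ v)
    (γv : Gamma0 N) (hγv : ((γv : SL(2, ℤ)) 1 1 : ℤ) = v) : (p : ℤ) ∣ kOf f γv := by
  haveI : NeZero p := ⟨hp.out.ne_zero⟩
  have hΩ := IsNewform0.plusPeriod_pos_holds hf hQ
  have hrat : ∀ r : ℚ, (ratPlusSymbol f r : ℝ) = normalizedPlusSymbol f r :=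
    fun r => ratCast_ratPlusSymbol_holds hf hQ r
  have hS := dvd_kOf_of_mem_pPowerCuspSet hf hQ hp2 hR0 hH
  have hΓ := dvd_kOf_of_mem_gammaPrimeSet hΩ hL hS
  have hv0Z : (v : ℤ) ≠ 0 := by exact_mod_cast hv0.ne'
  have hpZ : (p : ℤ) ≠ 0 := by exact_mod_cast hp.out.ne_zero
  have hv0Q : (v : ℚ) ≠ 0 := by exact_mod_cast hv0.ne'
  have hpQ : (p : ℚ) ≠ 0 := by exact_mod_cast hp.out.ne_zero
  have hpNZ : IsCoprime (p : ℤ) (N : ℤ) :=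
    Nat.isCoprime_iff_coprime.mpr ((Nat.Prime.coprime_iff_not_dvd hp.out).mpr hpN)
  have hvNZ : IsCoprime (v : ℤ) (N : ℤ) := Nat.isCoprime_iff_coprime.mpr hvN
  have hpvZ : IsCoprime (p : ℤ) (v : ℤ) :=
    Nat.isCoprime_iff_coprime.mpr ((Nat.Prime.coprime_iff_not_dvd hp.out).mpr hvp)
  -- every `R(s/t)`, `t = v·p^e`, `(t, sN) = 1`, is `R(0) + k_v/2 + p·m/2`
  have key : ∀ (s t : ℤ) (e : ℕ), t = v * (p : ℤ) ^ e → IsCoprime t (s * N) →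
      ∃ m : ℤ, ratPlusSymbol f ((s : ℚ) / (t : ℚ)) =
        ratPlusSymbol f 0 + (kOf f γv : ℚ) / 2 + (p : ℚ) * m / 2 := by
    intro s t e hte hcop
    obtain ⟨γ, hγb, hγd⟩ := exists_gamma0_entries N s t hcop
    have ht0 : t ≠ 0 := by rw [hte]; exact mul_ne_zero hv0Z (pow_ne_zero _ hpZ)
    have hdiff := ratPlusSymbol_sub_eq_kOf hf hQ γ (by rw [hγd]; exact ht0)
    rw [hγb, hγd] at hdiff
    have hcong : (p : ℤ) ∣ kOf f γ - kOf f γv := by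
      apply dvd_kOf_sub_of_apply_eq hΩ hΓ γ γv e
      rw [hγd, hγv, hte]; push_cast; ring
    obtain ⟨m, hm⟩ := hcong
    refine ⟨m, ?_⟩
    have hmQ : ((kOf f γ : ℤ) : ℚ) - kOf f γv = (p : ℚ) * m := by exact_mod_cast hm
    linarith [hdiff, hmQ]
  -- Hecke at r = 1/v
  have hHecke := intCast_mul_ratPlusSymbol p hf hp.out hpN hap' hrat (1 / (v : ℚ))
  -- the left-hand side R(1/v) itself
  have hlhs : ∃ m : ℤ, ratPlusSymbol f (1 / (v : ℚ)) =
      ratPlusSymbol f 0 + (kOf f γv : ℚ) / 2 + (p : ℚ) * m / 2 := by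
    have hx : (1 / (v : ℚ)) = (((1 : ℤ)) : ℚ) / ((v : ℤ) : ℚ) := by push_cast; ring
    rw [hx]
    exact key 1 v 0 (by simp) (by simpa using hvNZ)
  -- each term of the sum
  have hterm : ∀ j : Fin p, ∃ m : ℤ, ratPlusSymbol f ((1 / (v : ℚ) + ((j : ℕ) : ℚ)) / (p : ℚ)) =
      ratPlusSymbol f 0 + (kOf f γv : ℚ) / 2 + (p : ℚ) * m / 2 := by
    intro j
    have hvb : IsCoprime (v : ℤ) (1 + (j : ℕ) * v : ℤ) := ⟨-((j : ℕ) : ℤ), 1, by ring⟩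
    by_cases hdvd : (p : ℤ) ∣ (1 + (j : ℕ) * v : ℤ)
    · obtain ⟨b, hb⟩ := hdvd
      have hx : (1 / (v : ℚ) + ((j : ℕ) : ℚ)) / (p : ℚ) = ((b : ℤ) : ℚ) / ((v : ℤ) : ℚ) := by
        have hbQ : (1 : ℚ) + ((j : ℕ) : ℚ) * v = (p : ℚ) * b := by exact_mod_cast hb
        push_cast
        rw [div_add' _ _ _ hv0Q, div_div, div_eq_div_iff (mul_ne_zero hv0Q hpQ) hv0Q, hbQ]
        ring
      rw [hx]
      refine key b v 0 (by simp) ?_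
      have hvb' : IsCoprime (v : ℤ) b := by
        rw [hb] at hvb; exact hvb.of_mul_right_right
      exact hvb'.mul_right hvNZ
    · have hx : (1 / (v : ℚ) + ((j : ℕ) : ℚ)) / (p : ℚ) =
          (((1 + (j : ℕ) * v : ℤ)) : ℚ) / (((v * (p : ℤ) ^ 1 : ℤ)) : ℚ) := by
        push_cast
        rw [div_add' _ _ _ hv0Q, div_div, pow_one]
      rw [hx]
      refine key _ _ 1 rfl ?_
      have hpb : IsCoprime (p : ℤ) (1 + (j : ℕ) * v : ℤ) :=
        (Irreducible.coprime_iff_not_dvd (Nat.prime_iff_prime_int.mp hp.out).irreducible).mpr hdvd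
      rw [pow_one]
      exact (hvb.mul_left hpb).mul_right (hvNZ.mul_left hpNZ)
  -- the last term R(p/v)
  have hlast : ∃ m : ℤ, ratPlusSymbol f ((p : ℚ) * (1 / (v : ℚ))) =
      ratPlusSymbol f 0 + (kOf f γv : ℚ) / 2 + (p : ℚ) * m / 2 := by
    have hx : (p : ℚ) * (1 / (v : ℚ)) = (((p : ℤ)) : ℚ) / ((v : ℤ) : ℚ) := by push_cast; ring
    rw [hx]
    exact key p v 0 (by simp) ((hpvZ.symm).mul_right hvNZ)
  choose m hm using hterm
  obtain ⟨m', hm'⟩ := hlast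
  obtain ⟨m₀, hm₀⟩ := hlhs
  rw [hm₀, hm', Finset.sum_congr rfl (fun j _ => hm j)] at hHecke
  simp only [Finset.sum_add_distrib, Finset.sum_const, Finset.card_univ, Fintype.card_fin,
    nsmul_eq_mul] at hHecke
  -- hHecke : ap·(R0 + k/2 + p m₀/2) = (p·R0 + p·(k/2) + Σ p m_j/2) + (R0 + k/2 + p m'/2)
  have hsum : ∑ j : Fin p, (p : ℚ) * (m j : ℚ) / 2 = (p : ℚ) * ((∑ j : Fin p, m j : ℤ) : ℚ) / 2 := by
    push_cast; rw [Finset.mul_sum, Finset.sum_div]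
  rw [hsum] at hHecke
  have hmain : (((ap - p - 1 : ℤ)) : ℚ) * (ratPlusSymbol f 0 + (kOf f γv : ℚ) / 2) =
      (p : ℚ) * (((∑ j : Fin p, m j) + m' - ap * m₀ : ℤ) : ℚ) / 2 := by
    push_cast at hHecke ⊢; linarith
  have hlt : padicNorm p ((((ap - p - 1 : ℤ)) : ℚ) * (ratPlusSymbol f 0 + (kOf f γv : ℚ) / 2)) < 1 := by
    rw [hmain]; exact padicNorm_p_mul_int_div_two_lt_one hp2 _
  have hp1 : padicNorm p (((ap - p - 1 : ℤ)) : ℚ) = 1 := by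
    refine (padicNorm.int_eq_one_iff (p := p) (ap - p - 1)).mpr ?_
    intro hd
    apply hap1
    have : ap - 1 = (ap - p - 1) + p := by ring
    rw [this]
    exact dvd_add hd (dvd_refl _)
  rw [padicNorm.mul, hp1, one_mul] at hlt
  have h4 : padicNorm p ((kOf f γv : ℚ) / 2) < 1 := by
    have := padicNorm_sub_lt_one hlt hR0
    rwa [add_sub_cancel_left] at this
  exact dvd_of_padicNorm_div_two_lt_one hp2 h4

/-- **Step B5b** at `a_p = 0` (Hecke at `r = 1/v`): under `AllNonUnit` and LEMMA′, `p ∣ k_f(γ_v)`. -/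
theorem dvd_kOf_of_apply_eq_nat (hf : IsNewform0 f) (hQ : coeffField f = ⊥)
    (hp2 : p ≠ 2) (hpN : ¬ p ∣ N) (hap : cuspCoeff f p = 0) (hH : AllNonUnit f p)
    (hL : LemmaPrimeHom N p) (v : ℕ) (hv0 : 0 < v) (hvN : Nat.Coprime v N) (hvp : ¬ p ∣ v)
    (γv : Gamma0 N) (hγv : ((γv : SL(2, ℤ)) 1 1 : ℤ) = v) : (p : ℤ) ∣ kOf f γv := by
  have hap' : cuspCoeff f p = ((0 : ℤ) : ℂ) := by rw [hap]; simp
  have hR0 := padicNorm_ratPlusSymbol_zero_lt_one hf hQ hp2 hpN hap hH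
  have hap1 : ¬ (p : ℤ) ∣ (0 : ℤ) - 1 := by
    rw [zero_sub, dvd_neg]
    intro h
    exact hp.out.ne_one (by exact_mod_cast Int.eq_one_of_dvd_one (by positivity) h)
  exact dvd_kOf_of_apply_eq_nat_of_cuspCoeff hf hQ hp2 hpN hap' hap1 hR0 hH hL v hv0 hvN hvp γv hγv

/-- **THE SYMBOL STEP, general non-anomalous `a_p`** (EG-REDUCTION-g8 THEOREM A §4 and critic V40 (e) THEOREM
A′): for an odd prime `p ∤ N` and a rational newform `f` of level `N` with `a_p(f) ≢ 1 (mod p)`, LEMMA′(N,p) and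
`R(0) = [0]⁺_f ∈ pℤ_(p)` imply that NOT every `[a/p^k]⁺_f` (`k ≥ 1`, `p ∤ a`) vanishes mod `p`. -/
theorem not_allNonUnit_of_lemmaPrimeHom_of_cuspCoeff (hf : IsNewform0 f) (hQ : coeffField f = ⊥)
    (hp2 : p ≠ 2) (hpN : ¬ p ∣ N) {ap : ℤ} (hap' : cuspCoeff f p = ap) (hap1 : ¬ (p : ℤ) ∣ ap - 1)
    (hL : LemmaPrimeHom N p) (hR0 : padicNorm p (ratPlusSymbol f 0) < 1) :
    ¬ AllNonUnit f p := by
  intro hH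
  have hΩ := IsNewform0.plusPeriod_pos_holds hf hQ
  obtain ⟨γ₁, hγ₁⟩ := exists_kOf_eq_one hΩ
  -- d(γ₁) is a unit mod N
  have hdet := Matrix.SpecialLinearGroup.det_coe (γ₁ : SL(2, ℤ))
  rw [Matrix.det_fin_two] at hdet
  have hc : (((γ₁ : SL(2, ℤ)) 1 0 : ℤ) : ZMod N) = 0 := Gamma0_mem.mp γ₁.2
  have hunit : IsUnit ((((γ₁ : SL(2, ℤ)) 1 1 : ℤ)) : ZMod N) := by
    have h1 := congrArg (fun z : ℤ => (z : ZMod N)) hdet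
    simp only [Int.cast_sub, Int.cast_mul, Int.cast_one, hc, mul_zero, sub_zero] at h1
    exact IsUnit.of_mul_eq_one_right _ h1
  -- choose v > 0, v ≡ d(γ₁) mod N, p ∤ v
  obtain ⟨v0, hv0⟩ : ∃ v0 : ℕ, ((v0 : ℕ) : ZMod N) = ((((γ₁ : SL(2, ℤ)) 1 1 : ℤ)) : ZMod N) :=
    ⟨_, ZMod.natCast_zmod_val _⟩
  have hNpos : 0 < N := Nat.pos_of_ne_zero (NeZero.ne N)
  have hcand : ∀ i : ℕ, ((v0 + i * N : ℕ) : ZMod N) = ((((γ₁ : SL(2, ℤ)) 1 1 : ℤ)) : ZMod N) := by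
    intro i; push_cast; rw [ZMod.natCast_self, mul_zero, add_zero, hv0]
  obtain ⟨v, hvpos, hvd, hvp⟩ : ∃ v : ℕ, 0 < v ∧
      ((v : ℕ) : ZMod N) = ((((γ₁ : SL(2, ℤ)) 1 1 : ℤ)) : ZMod N) ∧ ¬ p ∣ v := by
    by_cases h1 : p ∣ v0 + 1 * N
    · refine ⟨v0 + 2 * N, by omega, hcand 2, fun h2 => hpN ?_⟩
      have h3 := Nat.dvd_sub h2 h1
      have e : v0 + 2 * N - (v0 + 1 * N) = N := by omega
      rwa [e] at h3
    · exact ⟨v0 + 1 * N, by omega, hcand 1, h1⟩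
  have hvN : Nat.Coprime v N := by
    have : IsUnit ((v : ℕ) : ZMod N) := by rw [hvd]; exact hunit
    exact (ZMod.isUnit_iff_coprime v N).mp this
  obtain ⟨γv, -, hγv⟩ := exists_gamma0_entries N 1 v
    (by simpa using (Nat.isCoprime_iff_coprime.mpr hvN : IsCoprime (v : ℤ) (N : ℤ)))
  have hkv := dvd_kOf_of_apply_eq_nat_of_cuspCoeff hf hQ hp2 hpN hap' hap1 hR0 hH hL v hvpos hvN hvp γv hγv
  have hS := dvd_kOf_of_mem_pPowerCuspSet hf hQ hp2 hR0 hH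
  have hΓ := dvd_kOf_of_mem_gammaPrimeSet hΩ hL hS
  have hcong := dvd_kOf_sub_of_apply_eq hΩ hΓ γ₁ γv 0
    (by rw [hγv, pow_zero, mul_one]; push_cast; exact hvd.symm)
  rw [hγ₁] at hcong
  have h1 : (p : ℤ) ∣ 1 := by
    have := dvd_add hcong hkv
    rwa [sub_add_cancel] at this
  have hp1 : (p : ℤ) = 1 := Int.eq_one_of_dvd_one (by positivity) h1
  exact hp.out.ne_one (by exact_mod_cast hp1)

/-- **THEOREM A′ symbol step (ordinary non-anomalous, critic V40 (e))**: for `p` odd, `p ∤ N`, `f` rational with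
`a_p ≢ 1 (mod p)`, LEMMA′(N,p) forbids `R(0) ∈ pℤ_(p)` together with `AllNonUnit` — which is what `μ(L_p(f)) ≥ 1`
gives in the ordinary case (`(1 − α⁻¹)² R(0) ∈ pℤ_p`, then the MTT recursion; classical, NOT formalised here). -/
theorem not_allNonUnit_and_of_lemmaPrimeHom (hf : IsNewform0 f) (hQ : coeffField f = ⊥)
    (hp2 : p ≠ 2) (hpN : ¬ p ∣ N) {ap : ℤ} (hap' : cuspCoeff f p = ap) (hap1 : ¬ (p : ℤ) ∣ ap - 1)
    (hL : LemmaPrimeHom N p) :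
    ¬ (padicNorm p (ratPlusSymbol f 0) < 1 ∧ AllNonUnit f p) :=
  fun h => not_allNonUnit_of_lemmaPrimeHom_of_cuspCoeff hf hQ hp2 hpN hap' hap1 hL h.1 h.2

/-- **THE SYMBOL STEP at `a_p = 0`** (EG-REDUCTION-g8 THEOREM A, §4): for an odd prime `p ∤ N` and a rational
newform `f` of level `N` with `a_p(f) = 0`, LEMMA′(N,p) implies that NOT every `[a/p^k]⁺_f` (`k ≥ 1`, `p ∤ a`)
vanishes mod `p` (`R(0) ∈ pℤ_(p)` is automatic here, Step B1). -/
theorem not_allNonUnit_of_lemmaPrimeHom (hf : IsNewform0 f) (hQ : coeffField f = ⊥)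
    (hp2 : p ≠ 2) (hpN : ¬ p ∣ N) (hap : cuspCoeff f p = 0) (hL : LemmaPrimeHom N p) :
    ¬ AllNonUnit f p := by
  intro hH
  have hap' : cuspCoeff f p = ((0 : ℤ) : ℂ) := by rw [hap]; simp
  have hR0 := padicNorm_ratPlusSymbol_zero_lt_one hf hQ hp2 hpN hap hH
  have hap1 : ¬ (p : ℤ) ∣ (0 : ℤ) - 1 := by
    rw [zero_sub, dvd_neg]
    intro h
    exact hp.out.ne_one (by exact_mod_cast Int.eq_one_of_dvd_one (by positivity) h)
  exact not_allNonUnit_of_lemmaPrimeHom_of_cuspCoeff hf hQ hp2 hpN hap' hap1 hL hR0 hH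

/-- From the unit-indexed form (`u` a unit of `ℤ/p^{n+1}`) to `AllNonUnit` (`ℤ`-periodicity of `[·]⁺_f`). -/
theorem allNonUnit_of_forall_units
    (h : ∀ (n : ℕ) (u : (ZMod (p ^ (n + 1)))ˣ),
      padicNorm p (ratPlusSymbol f (((u : ZMod (p ^ (n + 1))).val : ℚ) / (p : ℚ) ^ (n + 1))) < 1) :
    AllNonUnit f p := by
  intro k a hk hcop
  obtain ⟨n, rfl⟩ : ∃ n, k = n + 1 := ⟨k - 1, by omega⟩
  haveI : NeZero (p ^ (n + 1)) := ⟨pow_ne_zero _ hp.out.ne_zero⟩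
  have hu : IsUnit ((a : ℤ) : ZMod (p ^ (n + 1))) := by
    rw [ZMod.coe_int_isUnit_iff_isCoprime]
    push_cast
    exact ((IsCoprime.pow_right_iff (by omega : 0 < n + 1)).mpr hcop).symm
  obtain ⟨u, hu'⟩ := hu
  have hval : ((((u : ZMod (p ^ (n + 1))).val : ℕ)) : ℤ) = a % ((p : ℤ) ^ (n + 1)) := by
    rw [hu']
    have := ZMod.val_intCast (n := p ^ (n + 1)) a
    push_cast at this
    exact this
  have hper : ratPlusSymbol f ((a : ℚ) / (p : ℚ) ^ (n + 1)) =
      ratPlusSymbol f (((u : ZMod (p ^ (n + 1))).val : ℚ) / (p : ℚ) ^ (n + 1)) := by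
    have hpQ : (p : ℚ) ^ (n + 1) ≠ 0 := pow_ne_zero _ (by exact_mod_cast hp.out.ne_zero)
    have hdQ : (a : ℚ) = ((a % ((p : ℤ) ^ (n + 1)) : ℤ) : ℚ) +
        (p : ℚ) ^ (n + 1) * ((a / ((p : ℤ) ^ (n + 1)) : ℤ) : ℚ) := by
      have hdecomp : (a : ℤ) = a % ((p : ℤ) ^ (n + 1)) + (p : ℤ) ^ (n + 1) * (a / ((p : ℤ) ^ (n + 1))) := by
        have := Int.emod_add_mul_ediv a ((p : ℤ) ^ (n + 1)); linarith
      have := congrArg (Int.cast : ℤ → ℚ) hdecomp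
      push_cast at this
      exact this
    have e2 : ((((u : ZMod (p ^ (n + 1))).val : ℕ)) : ℚ) = ((a % ((p : ℤ) ^ (n + 1)) : ℤ) : ℚ) := by
      exact_mod_cast hval
    rw [e2, hdQ, add_div, mul_div_cancel_left₀ _ hpQ, ratPlusSymbol_add_intCast_eq]
  rw [hper]; exact h n u

end StepB

/-! ## §5 The one-sign μ-rider at `p = 3` from LEMMA′(N,3) alone -/

section Three

variable {N : ℕ} [NeZero N] {f : CuspForm (Gamma0 N) 2}

/-- **μ-rider at `p = 3` from LEMMA′.** For the newform `f` of an elliptic curve with good supersingular reduction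
at `3` (`a₃ = 0`), `LemmaPrimeHom N 3` gives a signed Pollack 3-adic `L`-function with unit content (`μ = 0` for one
sign). Inputs: the symbol step (`not_allNonUnit_of_lemmaPrimeHom`), the LEAD's landed
`SmallImageOrbitSumMuThree.norm_ratPlusSymbol_three_lt_one_of_not_hasUnitContent` (both signs without unit content ⇒
every `[u/3^{n+1}]⁺_f` vanishes mod 3) and the tree theorem `pollack_exists_plusMinusPAdicLFunction_holds`. -/
theorem exists_sign_hasUnitContent_three_of_lemmaPrimeHom {W : WeierstrassCurve ℚ} [W.IsElliptic]
    [W.IsGloballyMinimal] (hf : IsNewformOf W f) (hgood : W.HasGoodReductionAtPrime 3)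
    (hap : W.frobeniusTrace 3 = 0) (hL : LemmaPrimeHom N 3) :
    ∃ (ε : ℤˣ) (L : IwasawaAlgebra 3), IsSignedPAdicLFunction f 3 ε L ∧ HasUnitContent L := by
  have h32 : (3 : ℕ) ≠ 2 := by decide
  have h3N : ¬ 3 ∣ N := not_dvd_level_of_isNewformOf hf hgood
  have hap' : cuspCoeff f 3 = ((0 : ℤ) : ℂ) := by
    rw [cuspCoeff_eq_frobeniusTrace_of_isNewformOf_holds hf hgood, hap]
  have hap0 : cuspCoeff f 3 = 0 := by rw [hap']; simp
  by_contra hne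
  push_neg at hne
  -- both signed functions exist (Pollack, tree theorem) and, by `hne`, neither has unit content
  have hsym : ∀ (n : ℕ) (u : (ZMod (3 ^ (n + 1)))ˣ),
      padicNorm 3 (ratPlusSymbol f (((u : ZMod (3 ^ (n + 1))).val : ℚ) / (3 : ℚ) ^ (n + 1))) < 1 := by
    intro n u
    have hε : ∃ ε : ℤˣ, (Even n ∧ ε = 1) ∨ (Odd n ∧ ε = -1) := by
      rcases Nat.even_or_odd n with hn | hn
      · exact ⟨1, Or.inl ⟨hn, rfl⟩⟩
      · exact ⟨-1, Or.inr ⟨hn, rfl⟩⟩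
    obtain ⟨ε, hε⟩ := hε
    obtain ⟨L, -, hL'⟩ :=
      exists_isSignedPAdicLFunction (pollack_exists_plusMinusPAdicLFunction_holds) h32 hf hgood hap ε
    have hlt := Summit.BirchSwinnertonDyer.BirchSwinnertonDyer.Theorems.SmallImageOrbitSumMuThree.norm_ratPlusSymbol_three_lt_one_of_not_hasUnitContent
      f hf.1 h3N hap' hε hL' (hne ε L hL') u
    rw [Padic.eq_padicNorm] at hlt
    exact_mod_cast hlt
  exact not_allNonUnit_of_lemmaPrimeHom hf.1 hf.coeffField_eq_bot h32 h3N hap0 hL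
    (allNonUnit_of_forall_units hsym)

/-- **The v6 rider `stub_muOneSign_ns_three` of line `birth_acns`, in its `∃ ε₀ L₀` form, from the single
group-theoretic input `∀ N, ¬ 3 ∣ N → LemmaPrimeHom N 3`** (binders verbatim from the skeleton; `ClassX7 W 3` supplies
good reduction at 3; `¬ HasCM`, `¬ Surj` unused). Reshape suggestion for LEAD slh-p3 (v7): stub :=
`∀ N : ℕ, ¬ 3 ∣ N → LemmaPrimeHom N 3`, composition := this theorem. -/
theorem muOneSign_ns_three_of_lemmaPrimeHom (hL3 : ∀ N : ℕ, ¬ 3 ∣ N → LemmaPrimeHom N 3) :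
    ∀ (W : WeierstrassCurve ℚ) [W.IsElliptic] [W.IsGloballyMinimal],
    ClassX7 W 3 → ¬ W.HasCM → W.frobeniusTrace 3 = 0 → ¬ Surj W 3 →
    ∀ [NeZero (W.conductorNorm ℤ)] (f : CuspForm (Gamma0 (W.conductorNorm ℤ)) 2),
    IsNewformOf W f → ∃ (ε₀ : ℤˣ) (L₀ : IwasawaAlgebra 3),
      IsSignedPAdicLFunction f 3 ε₀ L₀ ∧ HasUnitContent L₀ := by
  intro W _ _ hX _ hap _ _ f hf
  exact exists_sign_hasUnitContent_three_of_lemmaPrimeHom hf hX.1.1 hap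
    (hL3 _ (not_dvd_level_of_isNewformOf hf hX.1.1))

/-- **Unit-symbol form** (general level): `LemmaPrimeHom N 3` ⟹ SOME `[u/3^{n+1}]⁺_f` (`u` a unit mod `3^{n+1}`) is a
3-adic UNIT — the symbol step combined with the tree's integrality `norm_ratPlusSymbol_div_pow_le_one`
(`[a/p^k]⁺ ∈ ℤ_(p)` for `p` odd, `p ∤ N`, `a_p = 0`; Pollack 2003 Thm. 5.6 / Stevens). -/
theorem exists_norm_ratPlusSymbol_three_eq_one_of_lemmaPrimeHom (hf : IsNewform0 f) (hQ : coeffField f = ⊥)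
    (h3N : ¬ 3 ∣ N) (hap : cuspCoeff f 3 = 0) (hL : LemmaPrimeHom N 3) :
    ∃ (n : ℕ) (u : (ZMod (3 ^ (n + 1)))ˣ),
      ‖((ratPlusSymbol f (((u : ZMod (3 ^ (n + 1))).val : ℚ) / (3 : ℚ) ^ (n + 1)) : ℚ) : ℚ_[3])‖ = 1 := by
  have h32 : (3 : ℕ) ≠ 2 := by decide
  have hap' : cuspCoeff f 3 = ((0 : ℤ) : ℂ) := by rw [hap]; simp
  by_contra hne
  push_neg at hne
  have hsym : ∀ (n : ℕ) (u : (ZMod (3 ^ (n + 1)))ˣ),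
      padicNorm 3 (ratPlusSymbol f (((u : ZMod (3 ^ (n + 1))).val : ℚ) / (3 : ℚ) ^ (n + 1))) < 1 := by
    intro n u
    have hle := norm_ratPlusSymbol_div_pow_le_one (f := f) h32 hf h3N hap' ((u : ZMod (3 ^ (n + 1))).val) (n + 1)
    have hlt : ‖((ratPlusSymbol f (((u : ZMod (3 ^ (n + 1))).val : ℚ) / (3 : ℚ) ^ (n + 1)) : ℚ) : ℚ_[3])‖ < 1 :=
      lt_of_le_of_ne (by exact_mod_cast hle) (hne n u)
    rw [Padic.eq_padicNorm] at hlt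
    exact_mod_cast hlt
  exact not_allNonUnit_of_lemmaPrimeHom hf hQ h32 h3N hap hL (allNonUnit_of_forall_units hsym)

/-- **The v6 stub `stub_muOneSign_ns_three` of line `birth_acns` EXACTLY AS TYPED (unit plus symbol form), from the
single group-theoretic input `∀ N, ¬ 3 ∣ N → LemmaPrimeHom N 3`** (binders verbatim from the skeleton). With this,
the LEAD may keep v6 and add `stub_lemmaPrimeHom_three : ∀ N : ℕ, ¬ 3 ∣ N → LemmaPrimeHom N 3`, closing
`stub_muOneSign_ns_three := stub_muOneSign_ns_three_of_lemmaPrimeHom stub_lemmaPrimeHom_three`. -/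
theorem stub_muOneSign_ns_three_of_lemmaPrimeHom (hL3 : ∀ N : ℕ, ¬ 3 ∣ N → LemmaPrimeHom N 3) :
    ∀ (W : WeierstrassCurve ℚ) [W.IsElliptic] [W.IsGloballyMinimal],
    ClassX7 W 3 → ¬ W.HasCM → W.frobeniusTrace 3 = 0 → ¬ Surj W 3 →
    ∀ [NeZero (W.conductorNorm ℤ)] (f : CuspForm (Gamma0 (W.conductorNorm ℤ)) 2),
    IsNewformOf W f → ∃ (n : ℕ) (u : (ZMod (3 ^ (n + 1)))ˣ),
      ‖((ratPlusSymbol f (((u : ZMod (3 ^ (n + 1))).val : ℚ) / (3 : ℚ) ^ (n + 1)) : ℚ) : ℚ_[3])‖ = 1 := by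
  intro W _ _ hX _ hap _ _ f hf
  have h3N := not_dvd_level_of_isNewformOf hf hX.1.1
  have hap0 : cuspCoeff f 3 = 0 := by
    rw [cuspCoeff_eq_frobeniusTrace_of_isNewformOf_holds hf hX.1.1, hap]; simp
  exact exists_norm_ratPlusSymbol_three_eq_one_of_lemmaPrimeHom hf.1 hf.coeffField_eq_bot h3N hap0 (hL3 _ h3N)

end Three

end Summit.BirchSwinnertonDyer.BirchSwinnertonDyer.Cruxes.KobayashiMainConjectureSmallImage.EGLine
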